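import Summits.AtomisticToContinuum.HydrodynamicLimit.Theses.JParityClosure
import Literature.MathematicalPhysics.KineticTheory.HardSphereEulerProofs
import HarnessLib

/-!
# L¹ relative deviation of an importance-weighted Gaussian KDE (K1b of P4)

Crux `JParityClosure.OddContactSymmetry` (stmt-AtomisticToContinuum-17722), line `KineticSlabSketch`,
registered stub `stub_weightedKdeDev_of` (glue form `K1a → K1b`).

For i.i.d. centred Maxwellian samples `v_k ∼ γ_θ` (`k ∈ κ`), fixed weights `0 ≤ p_k ≤ pmax` with
`P := Σ p_k > 0`, the Gaussian kernel `φ := M_{1,q,ϑ²}` and the query point `q`, the weighted kernel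
density estimate `h(v) := Σ_k p_k φ(v_k)` has mean `m̄ := P · M_{θ+ϑ²}(q)` (first kernel moment, K1a)
and, the coordinates being independent, variance `Σ_k p_k² Var φ ≤ pmax · P · E φ²`
with `E φ² = (4πϑ²)^{-3/2} M_{θ+ϑ²/2}(q) =: s̄` (second kernel moment, K1a). Cauchy–Schwarz on the
probability space then gives `E |h/m̄ − 1| ≤ √(Var h)/m̄ ≤ √(pmax/P) · √s̄ / M_{θ+ϑ²}(q)`.
-/

noncomputable section

open scoped BigOperators Classical InnerProductSpace ENNReal Topology
open Set MeasureTheory Filter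
open Literature.Analysis.FluidPDE Literature.MathematicalPhysics.KineticTheory

namespace Summit.AtomisticToContinuum.HydrodynamicLimit.Theorems.OddContactSymmetryKineticSlab

open ProbabilityTheory in
/-- **K1b.** L¹ relative deviation of an importance-weighted Gaussian kernel density estimate of
i.i.d. Maxwellian samples at one query point, from the Gaussian kernel moment identities (K1a):
`E |h/m̄ − 1| ≤ √(pmax/P) · √s̄(q) / m(q)` (variance of a weighted sum of independent bounded random
variables, then Cauchy–Schwarz). [folklore] -/
theorem stub_weightedKdeDev_of :
    (∀ {θ s : ℝ} (_hθ : 0 < θ) (_hs : 0 < s) (q : V3),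
    (∫ v, localMaxwellian 1 s q v ∂gaussMeasure (0 : V3) θ = localMaxwellian 1 (θ + s) 0 q) ∧
    (∫ v, localMaxwellian 1 s q v ^ 2 ∂gaussMeasure (0 : V3) θ =
        (4 * Real.pi * s) ^ (-(3 : ℝ) / 2) * localMaxwellian 1 (θ + s / 2) 0 q) ∧
    (∀ c : ℝ, c < 1 / (2 * θ) →
      ∫ v, Real.exp (c * ‖v‖ ^ 2) ∂gaussMeasure (0 : V3) θ = (1 - 2 * c * θ) ^ (-(3 : ℝ) / 2))) →
    ∀ {κ : Type} [Fintype κ] {θ ϑ : ℝ} (_hθ : 0 < θ) (_hϑ : 0 < ϑ) {p : κ → ℝ} {pmax : ℝ}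
    (_hp0 : ∀ k, 0 ≤ p k) (_hpm : ∀ k, p k ≤ pmax) (_hP : 0 < ∑ k, p k) (q : V3),
    ∫ v, |(∑ k, p k * localMaxwellian 1 (ϑ ^ 2) q (v k)) /
          ((∑ k, p k) * localMaxwellian 1 (θ + ϑ ^ 2) 0 q) - 1|
        ∂(Measure.pi fun _ : κ => gaussMeasure (0 : V3) θ) ≤
      Real.sqrt (pmax / ∑ k, p k) *
        (Real.sqrt ((4 * Real.pi * ϑ ^ 2) ^ (-(3 : ℝ) / 2) * localMaxwellian 1 (θ + ϑ ^ 2 / 2) 0 q) /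
          localMaxwellian 1 (θ + ϑ ^ 2) 0 q) := by
  intro hK κ _ θ ϑ hθ hϑ p pmax hp0 hpm hP q
  have hϑ2 : 0 < ϑ ^ 2 := by positivity
  obtain ⟨h1, h2, -⟩ := hK hθ hϑ2 q
  -- abbreviations: one-particle law, product law, kernel, mean and second moment at `q`
  set γ : Measure V3 := gaussMeasure (0 : V3) θ with hγdef
  set μ : Measure (κ → V3) := Measure.pi fun _ : κ => γ with hμdef
  set φ : V3 → ℝ := localMaxwellian 1 (ϑ ^ 2) q with hφdef
  set m : ℝ := localMaxwellian 1 (θ + ϑ ^ 2) 0 q with hmdef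
  set sbar : ℝ := (4 * Real.pi * ϑ ^ 2) ^ (-(3 : ℝ) / 2) * localMaxwellian 1 (θ + ϑ ^ 2 / 2) 0 q
    with hsdef
  have hm : 0 < m := localMaxwellian_pos one_pos (by positivity) 0 q
  have hPm : 0 < (∑ k, p k) * m := mul_pos hP hm
  have hsbar : 0 ≤ sbar := by rw [← h2]; exact integral_nonneg fun v => sq_nonneg _
  -- the kernel is continuous, nonnegative and bounded, hence square integrable
  have hφ_cont : Continuous φ := continuous_localMaxwellian 1 (ϑ ^ 2) q
  have hφ_sm : StronglyMeasurable φ := hφ_cont.stronglyMeasurable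
  have hφ_nn : ∀ v, 0 ≤ φ v := fun v => localMaxwellian_nonneg zero_le_one hϑ2.le q v
  have hφ_le : ∀ v, φ v ≤ 1 * (2 * Real.pi * ϑ ^ 2) ^ (-(Module.finrank ℝ V3 : ℝ) / 2) := by
    intro v
    show 1 * (2 * Real.pi * ϑ ^ 2) ^ (-(Module.finrank ℝ V3 : ℝ) / 2) *
        Real.exp (-‖v - q‖ ^ 2 / (2 * ϑ ^ 2)) ≤ _
    refine mul_le_of_le_one_right (by positivity) (Real.exp_le_one_iff.2 ?_)
    exact div_nonpos_of_nonpos_of_nonneg (neg_nonpos.2 (sq_nonneg _)) (by positivity)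
  have hφ_mem : MemLp φ 2 γ :=
    MemLp.of_bound hφ_sm.aestronglyMeasurable _ (ae_of_all _ fun v => by
      rw [Real.norm_eq_abs, abs_of_nonneg (hφ_nn v)]; exact hφ_le v)
  have hX_mem : ∀ i, MemLp (fun v => p i * φ v) 2 γ := fun i => hφ_mem.const_mul (p i)
  -- the weighted KDE numerator as a random variable on the product space
  set H : (κ → V3) → ℝ := ∑ i, fun v => p i * φ (v i) with hHdef
  have hH_apply : ∀ v, H v = ∑ i, p i * φ (v i) := fun v => by
    simp only [hHdef, Finset.sum_apply]
  -- (ii) variance: independence of the coordinates, `Var (p φ) = p² Var φ ≤ p² E φ² ≤ pmax p s̄`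
  have hVarH : Var[H; μ] = ∑ i, Var[fun v => p i * φ v; γ] :=
    variance_sum_pi (X := fun i v => p i * φ v) hX_mem
  have hVφ : Var[φ; γ] ≤ sbar := by
    have := variance_le_expectation_sq (μ := γ) hφ_sm.aestronglyMeasurable
    simpa only [Pi.pow_apply, h2] using this
  have hterm : ∀ i, Var[fun v => p i * φ v; γ] ≤ pmax * p i * sbar := fun i => by
    rw [variance_const_mul]
    calc p i ^ 2 * Var[φ; γ] ≤ p i ^ 2 * sbar := mul_le_mul_of_nonneg_left hVφ (sq_nonneg _)
      _ = p i * p i * sbar := by rw [sq]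
      _ ≤ pmax * p i * sbar :=
          mul_le_mul_of_nonneg_right (mul_le_mul_of_nonneg_right (hpm i) (hp0 i)) hsbar
  have hVar_le : Var[H; μ] ≤ pmax * (∑ k, p k) * sbar := by
    calc Var[H; μ] = ∑ i, Var[fun v => p i * φ v; γ] := hVarH
      _ ≤ ∑ i, pmax * p i * sbar := Finset.sum_le_sum fun i _ => hterm i
      _ = pmax * (∑ k, p k) * sbar := by rw [Finset.mul_sum, Finset.sum_mul]
  -- (i) mean: `E φ(v_i) = m` coordinatewise (first kernel moment), so `E H = P m`
  have hEφi : ∀ i, ∫ v, φ (v i) ∂μ = m := fun i => by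
    rw [← h1, ← (measurePreserving_eval (fun _ : κ => γ) i).map_eq]
    exact (integral_map_of_stronglyMeasurable
      (measurePreserving_eval (fun _ : κ => γ) i).measurable hφ_sm).symm
  have hXi_mem : ∀ i, MemLp (fun v : κ → V3 => p i * φ (v i)) 2 μ := fun i =>
    (hX_mem i).comp_measurePreserving (measurePreserving_eval (fun _ : κ => γ) i)
  have hφi_int : ∀ i, Integrable (fun v : κ → V3 => φ (v i)) μ := fun i =>
    (hφ_mem.comp_measurePreserving (measurePreserving_eval (fun _ : κ => γ) i)).integrable
      one_le_two
  have hEH : ∫ v, H v ∂μ = (∑ k, p k) * m := by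
    simp_rw [hH_apply]
    rw [integral_finsetSum _ fun i _ => (hφi_int i).const_mul (p i), Finset.sum_mul]
    refine Finset.sum_congr rfl fun i _ => ?_
    rw [integral_const_mul, hEφi]
  have hH_mem : MemLp H 2 μ := by
    simpa only [hHdef] using memLp_finsetSum' _ fun i _ => hXi_mem i
  have hVar_int : Var[H; μ] = ∫ v, (H v - (∑ k, p k) * m) ^ 2 ∂μ := by
    rw [variance_eq_integral hH_mem.aestronglyMeasurable.aemeasurable, hEH]
  -- (iii) Cauchy–Schwarz: `(E |H - P m|)² ≤ E (H - P m)² = Var H`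
  set Y : (κ → V3) → ℝ := fun v => |H v - (∑ k, p k) * m| with hYdef
  have hY_mem : MemLp Y 2 μ := (hH_mem.sub (memLp_const _)).abs
  have hEY_sq : (∫ v, Y v ∂μ) ^ 2 ≤ ∫ v, Y v ^ 2 ∂μ := by
    have h0 := variance_nonneg Y μ
    rw [variance_eq_sub hY_mem] at h0
    simp only [Pi.pow_apply] at h0
    linarith
  have hY_sq : ∫ v, Y v ^ 2 ∂μ = ∫ v, (H v - (∑ k, p k) * m) ^ 2 ∂μ := by
    simp only [hYdef, sq_abs]
  have key : ∫ v, Y v ∂μ ≤ Real.sqrt (pmax * (∑ k, p k) * sbar) := by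
    apply Real.le_sqrt_of_sq_le
    calc (∫ v, Y v ∂μ) ^ 2 ≤ ∫ v, Y v ^ 2 ∂μ := hEY_sq
      _ = Var[H; μ] := by rw [hY_sq, hVar_int]
      _ ≤ pmax * (∑ k, p k) * sbar := hVar_le
  -- conclusion
  have hint_eq : ∫ v, |(∑ k, p k * φ (v k)) / ((∑ k, p k) * m) - 1| ∂μ =
      (∫ v, Y v ∂μ) / ((∑ k, p k) * m) := by
    rw [← integral_div]
    refine integral_congr_ae (ae_of_all _ fun v => ?_)
    simp only [hYdef]
    rw [← hH_apply v, div_sub_one hPm.ne', abs_div, abs_of_pos hPm]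
  rw [hint_eq]
  calc (∫ v, Y v ∂μ) / ((∑ k, p k) * m)
      ≤ Real.sqrt (pmax * (∑ k, p k) * sbar) / ((∑ k, p k) * m) :=
        div_le_div_of_nonneg_right key hPm.le
    _ = Real.sqrt (pmax / ∑ k, p k) * (Real.sqrt sbar / m) := by
        rw [show pmax * (∑ k, p k) * sbar = (pmax / ∑ k, p k) * ((∑ k, p k) ^ 2 * sbar) by
            field_simp,
          Real.sqrt_mul' _ (by positivity), Real.sqrt_mul (sq_nonneg _), Real.sqrt_sq hP.le]
        field_simp

end Summit.AtomisticToContinuum.HydrodynamicLimit.Theorems.OddContactSymmetryKineticSlab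

end
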